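import Mathlib
import HarnessLib
import Summits.Ventures.LatticeQCDFlow.Exactness.SU2ExpDriftWork

/-!
# `SU(2)` rung — THE ENERGY ERROR OF ONE STEP OF THE ENGINE'S OMF2 INTEGRATOR (`K(λ) D(½) K(1−2λ) D(½) K(λ)` with the Pauli drift and the consistent kicks) IS SECOND ORDER, WITH EXPLICIT CONSTANTS — the energy identity and the bound, for ANY action

HONEST FRAMING: exact (Metropolis-corrected) sampling algorithms for lattice gauge theory;
figures of merit are autocorrelation/cost numbers at stated couplings and volumes; no
continuum-physics claim.

Venture `LatticeQCDFlow` (cell pub-lqcd), topic `Exactness`; FANOUT row 14 (`eng-flowhmc`, engine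
`latflow.fthmc`, family B, `dynamics.Dynamics(integrator = "omf2")`: the word `omf2Word g₁ (mulDrift e_δ) g₂ =
K(g₁) D(e_δ) K(g₂) D(e_δ) K(g₁)` of `SplittingWords`, exact by `GaugeFTHMCSymmetricWord` / `SU2FTHMCIntegrators` for ANY
kicks).  The OMF2 twin of `SU2LeapfrogEnergyError` §3.  NEW WORK of the cell over `SU2ExpDriftWork` (the Pauli drift
`su2ExpDrift δ` moves a configuration by `≤ 8|δ|‖p‖` in the matrix sup norm; first-order Taylor with explicit remainder
`4|δ|K‖p‖Σ‖p_l‖`), row 9's `SU2MultiStepLeapfrogHMC` (`su2ExpDrift`, `su2Kinetic κ p = κΣ‖p_l‖²`), `SplittingWords`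
(`omf2Word`, `palindromicWord`, `kick`, `drift`, `mulDrift`); nothing is cited as a fact; no number.  `S : (ι → SU(2)) → ℝ`
is ARBITRARY; `D = D^δ S` is its coordinate gradient along the HALF-step drift `e_δ` (`‖D(W)_l‖ ≤ D_max`,
`‖D(W) − D(W')‖ ≤ K‖coeConfig W − coeConfig W'‖`); the kicks are the CONSISTENT ones for `H = S + κΣ‖p_l‖²`:
`g₁ = −(λ/κ)D`, `g₂ = −((1−2λ)/κ)D` (fractions `λ, 1−2λ, λ` of the full-step kick `−D/κ`; `λ = ½` is two leapfrog steps of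
`SU2LeapfrogEnergyError` with half-step `δ`).

* `su2Omf2Step_apply` — the word read off: `(q, p) ↦ (q₂, p₃)` with `p₁ = p + g₁ q`, `q₁ = e_δ(p₁)·q`, `p₂ = p₁ + g₂ q₁`,
  `q₂ = e_δ(p₂)·q₁`, `p₃ = p₂ + g₁ q₂`;
* `su2Kinetic_kick_increment` — `κ(‖x − (c/κ)v‖² − ‖x‖²) = −c(⟪x, v⟫ + ⟪x − (c/κ)v, v⟫)`;
* **`su2Omf2_energy_identity`** — `H(q₂,p₃) − H(q,p) = (1−2λ)Σ⟪p₁, D q − D q₁⟫ + 2λΣ⟪p₂, D q₁ − D q₂⟫ +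
  (λ²/κ)Σ(‖D q₂‖² − ‖D q‖²) + [S q₁ − S q − Σ⟪D q, p₁⟫] + [S q₂ − S q₁ − Σ⟪D q₁, p₂⟫]` EXACTLY — the first-order terms cancel
  because the kick fractions sum to the drift fractions (`λ + (1−2λ) + λ = ½ + ½`);
* `norm_su2FracKick_apply_le` / `norm_su2FracKick_le` (`‖−(c/κ)D‖ ≤ |c|D_max/κ`);
* **`abs_su2Omf2_energy_error_le`** — with `γ = (|λ| + |1−2λ|)D_max/κ`:
  `|ΔH| ≤ K|δ|·(‖p‖ + γ)·((8|1−2λ| + 16|λ| + 8)·(Σ_l‖p_l‖ + |ι|γ) + 32λ²|ι|D_max/κ)` — SECOND ORDER in the step (`K, D_max = O(δ)`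
  for the tree's exact forces), linear in the number of links, every constant explicit.

NOT CLAIMED: the `n`-step trajectory and the proposal (`SU2Omf2TrajectoryEnergyError`); OMF4; optimal constants; the
instantiation for the two members; floating point; any number.
-/

noncomputable section

namespace Summit.Ventures.LatticeQCDFlow.Exactness

open Set Function MeasureTheory NormedSpace
open Literature.MathematicalPhysics.QuantumFieldTheory
open Literature.MathematicalPhysics.QuantumFieldTheory.Balaban1983to89.B10Eq18SigmaSU2Haar (expPauli)
open scoped Matrix Matrix.Norms.Operator InnerProductSpace

set_option backward.isDefEq.respectTransparency false

variable {ι : Type*} [Fintype ι] [DecidableEq ι]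

omit [Fintype ι] [DecidableEq ι] in
/-- **The OMF2 word `omf2Word g₁ (mulDrift (su2ExpDrift δ)) g₂` is kick–drift–kick–drift–kick, read off**:
`(q, p) ↦ (q₂, p₂ + g₁ q₂)` with `p₁ = p + g₁ q`, `q₁ = e_δ(p₁)·q`, `p₂ = p₁ + g₂ q₁`, `q₂ = e_δ(p₂)·q₁`. -/
theorem su2Omf2Step_apply (g₁ g₂ : (ι → Matrix.specialUnitaryGroup (Fin 2) ℂ) → ι → EuclideanSpace ℝ (Fin 3)) (δ : ℝ)
    (q : ι → Matrix.specialUnitaryGroup (Fin 2) ℂ) (p : ι → EuclideanSpace ℝ (Fin 3)) :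
    omf2Word g₁ (mulDrift (su2ExpDrift δ)) g₂ (q, p) =
      (su2ExpDrift δ ((p + g₁ q) + g₂ (su2ExpDrift δ (p + g₁ q) * q)) * (su2ExpDrift δ (p + g₁ q) * q),
        ((p + g₁ q) + g₂ (su2ExpDrift δ (p + g₁ q) * q)) +
          g₁ (su2ExpDrift δ ((p + g₁ q) + g₂ (su2ExpDrift δ (p + g₁ q) * q)) * (su2ExpDrift δ (p + g₁ q) * q))) := by
  simp only [omf2Word, palindromicWord, List.prod_cons, List.prod_nil, mul_one, List.reverse_cons, List.reverse_nil,
    List.nil_append, List.cons_append, Equiv.Perm.mul_apply]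
  rfl

omit [Fintype ι] [DecidableEq ι] in
/-- The kinetic increment of a kick by the fraction `c` of the consistent full-step kick:
`κ(‖x − (c/κ)v‖² − ‖x‖²) = −c(⟪x, v⟫ + ⟪x − (c/κ)v, v⟫)`. -/
theorem su2Kinetic_kick_increment (κ c : ℝ) (hκ : κ ≠ 0) (x v : EuclideanSpace ℝ (Fin 3)) :
    κ * (‖x + (-(c / κ)) • v‖ ^ 2 - ‖x‖ ^ 2) = -c * (⟪x, v⟫_ℝ + ⟪x + (-(c / κ)) • v, v⟫_ℝ) := by
  have h1 : ‖x + (-(c / κ)) • v‖ ^ 2 = ‖x‖ ^ 2 + 2 * ⟪x, (-(c / κ)) • v⟫_ℝ + ‖(-(c / κ)) • v‖ ^ 2 :=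
    norm_add_sq_real _ _
  have h2 : ‖(-(c / κ)) • v‖ ^ 2 = (c / κ) ^ 2 * ‖v‖ ^ 2 := by
    rw [norm_smul, mul_pow, Real.norm_eq_abs, abs_neg, sq_abs]
  rw [h1, h2, real_inner_smul_right, inner_add_left, real_inner_smul_left, real_inner_self_eq_norm_sq]
  field_simp
  ring

/-- **THE OMF2 ENERGY IDENTITY FOR THE CONSISTENT KICKS `g₁ = −(λ/κ)D`, `g₂ = −((1−2λ)/κ)D`** (`D = (fun (W : ι → Matrix.specialUnitaryGroup (Fin 2) ℂ) (l : ι) => WithLp.toLp 2 (fun i : Fin 3 => fderiv ℝ (fun a : ι → EuclideanSpace ℝ (Fin 3) => S (su2ExpDrift δ a * W)) 0 (Pi.single l (EuclideanSpace.single i (1 : ℝ)))))`, two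
drifts `e_δ`, `H = S + κΣ‖p_l‖²`): with `p₁ = p + g₁ q`, `q₁ = e_δ(p₁)·q`, `p₂ = p₁ + g₂ q₁`, `q₂ = e_δ(p₂)·q₁`,
`p₃ = p₂ + g₁ q₂`,
`H(q₂,p₃) − H(q,p) = (1−2λ)Σ⟪p₁, D q − D q₁⟫ + 2λΣ⟪p₂, D q₁ − D q₂⟫ + (λ²/κ)Σ(‖D q₂‖² − ‖D q‖²)`
`  + [S q₁ − S q − Σ⟪D q, p₁⟫] + [S q₂ − S q₁ − Σ⟪D q₁, p₂⟫]` — every term second order. -/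
theorem su2Omf2_energy_identity (S : (ι → Matrix.specialUnitaryGroup (Fin 2) ℂ) → ℝ) (δ κ lam : ℝ) (hκ : κ ≠ 0)
    (q : ι → Matrix.specialUnitaryGroup (Fin 2) ℂ) (p : ι → EuclideanSpace ℝ (Fin 3)) :
    let D := (fun (W : ι → Matrix.specialUnitaryGroup (Fin 2) ℂ) (l : ι) => WithLp.toLp 2 (fun i : Fin 3 => fderiv ℝ (fun a : ι → EuclideanSpace ℝ (Fin 3) => S (su2ExpDrift δ a * W)) 0 (Pi.single l (EuclideanSpace.single i (1 : ℝ)))))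
    let g₁ := (fun (W : ι → Matrix.specialUnitaryGroup (Fin 2) ℂ) (l : ι) => -(lam / κ) • (fun (W : ι → Matrix.specialUnitaryGroup (Fin 2) ℂ) (l : ι) => WithLp.toLp 2 (fun i : Fin 3 => fderiv ℝ (fun a : ι → EuclideanSpace ℝ (Fin 3) => S (su2ExpDrift δ a * W)) 0 (Pi.single l (EuclideanSpace.single i (1 : ℝ))))) W l)
    let g₂ := (fun (W : ι → Matrix.specialUnitaryGroup (Fin 2) ℂ) (l : ι) => -((1 - 2 * lam) / κ) • (fun (W : ι → Matrix.specialUnitaryGroup (Fin 2) ℂ) (l : ι) => WithLp.toLp 2 (fun i : Fin 3 => fderiv ℝ (fun a : ι → EuclideanSpace ℝ (Fin 3) => S (su2ExpDrift δ a * W)) 0 (Pi.single l (EuclideanSpace.single i (1 : ℝ))))) W l)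
    let p₁ := p + g₁ q
    let q₁ := su2ExpDrift δ p₁ * q
    let p₂ := p₁ + g₂ q₁
    let q₂ := su2ExpDrift δ p₂ * q₁
    let p₃ := p₂ + g₁ q₂
    (S q₂ + su2Kinetic κ p₃) - (S q + su2Kinetic κ p) =
      (1 - 2 * lam) * ∑ l, ⟪p₁ l, D q l - D q₁ l⟫_ℝ + 2 * lam * ∑ l, ⟪p₂ l, D q₁ l - D q₂ l⟫_ℝ +
        lam ^ 2 / κ * ∑ l, (‖D q₂ l‖ ^ 2 - ‖D q l‖ ^ 2) +
        ((S q₁ - S q - ∑ l, ⟪D q l, p₁ l⟫_ℝ) + (S q₂ - S q₁ - ∑ l, ⟪D q₁ l, p₂ l⟫_ℝ)) := by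
  intro D g₁ g₂ p₁ q₁ p₂ q₂ p₃
  -- the three kinetic increments, link by link
  have K1 : ∀ l, κ * (‖p₁ l‖ ^ 2 - ‖p l‖ ^ 2) = -lam * (⟪p l, D q l⟫_ℝ + ⟪p₁ l, D q l⟫_ℝ) := fun l =>
    su2Kinetic_kick_increment κ lam hκ (p l) (D q l)
  have K2 : ∀ l, κ * (‖p₂ l‖ ^ 2 - ‖p₁ l‖ ^ 2) = -(1 - 2 * lam) * (⟪p₁ l, D q₁ l⟫_ℝ + ⟪p₂ l, D q₁ l⟫_ℝ) := fun l =>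
    su2Kinetic_kick_increment κ (1 - 2 * lam) hκ (p₁ l) (D q₁ l)
  have K3 : ∀ l, κ * (‖p₃ l‖ ^ 2 - ‖p₂ l‖ ^ 2) = -lam * (⟪p₂ l, D q₂ l⟫_ℝ + ⟪p₃ l, D q₂ l⟫_ℝ) := fun l =>
    su2Kinetic_kick_increment κ lam hκ (p₂ l) (D q₂ l)
  -- the outer momenta read through the inner ones
  have hP0 : ∀ l, ⟪p l, D q l⟫_ℝ = ⟪p₁ l, D q l⟫_ℝ + lam / κ * ‖D q l‖ ^ 2 := by
    intro l
    have e : p l = p₁ l + (lam / κ) • D q l := by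
      show p l = (p l + (-(lam / κ)) • D q l) + (lam / κ) • D q l
      rw [add_assoc, ← add_smul, neg_add_cancel, zero_smul, add_zero]
    rw [e, inner_add_left, real_inner_smul_left, real_inner_self_eq_norm_sq]
  have hP3 : ∀ l, ⟪p₃ l, D q₂ l⟫_ℝ = ⟪p₂ l, D q₂ l⟫_ℝ - lam / κ * ‖D q₂ l‖ ^ 2 := by
    intro l
    show ⟪p₂ l + (-(lam / κ)) • D q₂ l, D q₂ l⟫_ℝ = _
    rw [inner_add_left, real_inner_smul_left, real_inner_self_eq_norm_sq]
    ring
  have key : ∀ l, κ * (‖p₃ l‖ ^ 2 - ‖p l‖ ^ 2) =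
      (1 - 2 * lam) * ⟪p₁ l, D q l - D q₁ l⟫_ℝ + 2 * lam * ⟪p₂ l, D q₁ l - D q₂ l⟫_ℝ +
        lam ^ 2 / κ * (‖D q₂ l‖ ^ 2 - ‖D q l‖ ^ 2) - ⟪D q l, p₁ l⟫_ℝ - ⟪D q₁ l, p₂ l⟫_ℝ := by
    intro l
    rw [inner_sub_right, inner_sub_right, real_inner_comm (p₁ l) (D q l), real_inner_comm (p₂ l) (D q₁ l)]
    have hk : κ * (‖p₃ l‖ ^ 2 - ‖p l‖ ^ 2) =
        κ * (‖p₁ l‖ ^ 2 - ‖p l‖ ^ 2) + κ * (‖p₂ l‖ ^ 2 - ‖p₁ l‖ ^ 2) + κ * (‖p₃ l‖ ^ 2 - ‖p₂ l‖ ^ 2) := by ring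
    rw [hk, K1, K2, K3, hP0, hP3]
    field_simp
    ring
  have hsum : κ * ∑ l, (‖p₃ l‖ ^ 2 - ‖p l‖ ^ 2) =
      (1 - 2 * lam) * ∑ l, ⟪p₁ l, D q l - D q₁ l⟫_ℝ + 2 * lam * ∑ l, ⟪p₂ l, D q₁ l - D q₂ l⟫_ℝ +
        lam ^ 2 / κ * ∑ l, (‖D q₂ l‖ ^ 2 - ‖D q l‖ ^ 2) - ∑ l, ⟪D q l, p₁ l⟫_ℝ - ∑ l, ⟪D q₁ l, p₂ l⟫_ℝ := by
    rw [Finset.mul_sum, Finset.mul_sum, Finset.mul_sum, Finset.mul_sum, ← Finset.sum_add_distrib, ← Finset.sum_add_distrib,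
      ← Finset.sum_sub_distrib, ← Finset.sum_sub_distrib]
    exact Finset.sum_congr rfl fun l _ => key l
  simp only [su2Kinetic]
  have hsplit : κ * ∑ l, ‖p₃ l‖ ^ 2 - κ * ∑ l, ‖p l‖ ^ 2 = κ * ∑ l, (‖p₃ l‖ ^ 2 - ‖p l‖ ^ 2) := by
    rw [Finset.sum_sub_distrib, mul_sub]
  linarith [hsum, hsplit]

omit [Fintype ι] in
/-- The fractional kick `−(c/κ)D` is bounded by `|c|·D_max/κ` linkwise (`κ > 0`). -/
theorem norm_su2FracKick_apply_le (S : (ι → Matrix.specialUnitaryGroup (Fin 2) ℂ) → ℝ) (δ κ c : ℝ) (hκ : 0 < κ) {Dmax : ℝ}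
    (hDb : ∀ (W : ι → Matrix.specialUnitaryGroup (Fin 2) ℂ) (l : ι), ‖(fun (W : ι → Matrix.specialUnitaryGroup (Fin 2) ℂ) (l : ι) => WithLp.toLp 2 (fun i : Fin 3 => fderiv ℝ (fun a : ι → EuclideanSpace ℝ (Fin 3) => S (su2ExpDrift δ a * W)) 0 (Pi.single l (EuclideanSpace.single i (1 : ℝ))))) W l‖ ≤ Dmax)
    (W : ι → Matrix.specialUnitaryGroup (Fin 2) ℂ) (l : ι) : ‖(fun (W : ι → Matrix.specialUnitaryGroup (Fin 2) ℂ) (l : ι) => -(c / κ) • (fun (W : ι → Matrix.specialUnitaryGroup (Fin 2) ℂ) (l : ι) => WithLp.toLp 2 (fun i : Fin 3 => fderiv ℝ (fun a : ι → EuclideanSpace ℝ (Fin 3) => S (su2ExpDrift δ a * W)) 0 (Pi.single l (EuclideanSpace.single i (1 : ℝ))))) W l) W l‖ ≤ |c| * (Dmax / κ) := by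
  simp only [norm_smul, norm_neg, Real.norm_eq_abs, abs_div, abs_of_pos hκ]
  calc |c| / κ * ‖(fun (W : ι → Matrix.specialUnitaryGroup (Fin 2) ℂ) (l : ι) => WithLp.toLp 2 (fun i : Fin 3 => fderiv ℝ (fun a : ι → EuclideanSpace ℝ (Fin 3) => S (su2ExpDrift δ a * W)) 0 (Pi.single l (EuclideanSpace.single i (1 : ℝ))))) W l‖ ≤ |c| / κ * Dmax := by gcongr; exact hDb W l
    _ = |c| * (Dmax / κ) := by ring

/-- The fractional kick is bounded by `|c|·D_max/κ` in the sup norm. -/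
theorem norm_su2FracKick_le (S : (ι → Matrix.specialUnitaryGroup (Fin 2) ℂ) → ℝ) (δ κ c : ℝ) (hκ : 0 < κ) {Dmax : ℝ}
    (hD0 : 0 ≤ Dmax) (hDb : ∀ (W : ι → Matrix.specialUnitaryGroup (Fin 2) ℂ) (l : ι), ‖(fun (W : ι → Matrix.specialUnitaryGroup (Fin 2) ℂ) (l : ι) => WithLp.toLp 2 (fun i : Fin 3 => fderiv ℝ (fun a : ι → EuclideanSpace ℝ (Fin 3) => S (su2ExpDrift δ a * W)) 0 (Pi.single l (EuclideanSpace.single i (1 : ℝ))))) W l‖ ≤ Dmax)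
    (W : ι → Matrix.specialUnitaryGroup (Fin 2) ℂ) : ‖(fun (W : ι → Matrix.specialUnitaryGroup (Fin 2) ℂ) (l : ι) => -(c / κ) • (fun (W : ι → Matrix.specialUnitaryGroup (Fin 2) ℂ) (l : ι) => WithLp.toLp 2 (fun i : Fin 3 => fderiv ℝ (fun a : ι → EuclideanSpace ℝ (Fin 3) => S (su2ExpDrift δ a * W)) 0 (Pi.single l (EuclideanSpace.single i (1 : ℝ))))) W l) W‖ ≤ |c| * (Dmax / κ) :=
  (pi_norm_le_iff_of_nonneg (by positivity)).2 fun l => norm_su2FracKick_apply_le S δ κ c hκ hDb W l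

set_option maxHeartbeats 400000 in -- RN-23 (7)(b): heavy declaration budgeted at source (lake build ≈ 10 % hungrier than the gate)
/-- **THE ENERGY ERROR OF ONE OMF2 STEP IS SECOND ORDER, EXPLICITLY.**  If `a ↦ S(e_δ(a)·W)` is differentiable at `0`
for every `W`, `‖D(W)_l‖ ≤ D_max` and `‖D(W) − D(W')‖ ≤ K‖coeConfig W − coeConfig W'‖` (`D = (fun (W : ι → Matrix.specialUnitaryGroup (Fin 2) ℂ) (l : ι) => WithLp.toLp 2 (fun i : Fin 3 => fderiv ℝ (fun a : ι → EuclideanSpace ℝ (Fin 3) => S (su2ExpDrift δ a * W)) 0 (Pi.single l (EuclideanSpace.single i (1 : ℝ)))))`), then for the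
consistent kicks `g₁ = −(λ/κ)D`, `g₂ = −((1−2λ)/κ)D` (`κ > 0`), with `γ = (|λ| + |1−2λ|)·D_max/κ`, `P = ‖p‖ + γ`,
`Σ = Σ_l‖p_l‖ + |ι|γ`:
`|H(q₂,p₃) − H(q,p)| ≤ K|δ|·P·((8|1−2λ| + 16|λ| + 8)·Σ + 32λ²|ι|D_max/κ)`. -/
theorem abs_su2Omf2_energy_error_le (S : (ι → Matrix.specialUnitaryGroup (Fin 2) ℂ) → ℝ) (δ κ lam : ℝ) (hκ : 0 < κ)
    (hd : ∀ W : ι → Matrix.specialUnitaryGroup (Fin 2) ℂ,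
      DifferentiableAt ℝ (fun a : ι → EuclideanSpace ℝ (Fin 3) => S (su2ExpDrift δ a * W)) 0)
    {Dmax K : ℝ} (hD0 : 0 ≤ Dmax) (hK0 : 0 ≤ K)
    (hDb : ∀ (W : ι → Matrix.specialUnitaryGroup (Fin 2) ℂ) (l : ι), ‖(fun (W : ι → Matrix.specialUnitaryGroup (Fin 2) ℂ) (l : ι) => WithLp.toLp 2 (fun i : Fin 3 => fderiv ℝ (fun a : ι → EuclideanSpace ℝ (Fin 3) => S (su2ExpDrift δ a * W)) 0 (Pi.single l (EuclideanSpace.single i (1 : ℝ))))) W l‖ ≤ Dmax)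
    (hDK : ∀ W W' : ι → Matrix.specialUnitaryGroup (Fin 2) ℂ, ‖(fun (W : ι → Matrix.specialUnitaryGroup (Fin 2) ℂ) (l : ι) => WithLp.toLp 2 (fun i : Fin 3 => fderiv ℝ (fun a : ι → EuclideanSpace ℝ (Fin 3) => S (su2ExpDrift δ a * W)) 0 (Pi.single l (EuclideanSpace.single i (1 : ℝ))))) W - (fun (W : ι → Matrix.specialUnitaryGroup (Fin 2) ℂ) (l : ι) => WithLp.toLp 2 (fun i : Fin 3 => fderiv ℝ (fun a : ι → EuclideanSpace ℝ (Fin 3) => S (su2ExpDrift δ a * W)) 0 (Pi.single l (EuclideanSpace.single i (1 : ℝ))))) W'‖ ≤ K * ‖coeConfig W - coeConfig W'‖)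
    (q : ι → Matrix.specialUnitaryGroup (Fin 2) ℂ) (p : ι → EuclideanSpace ℝ (Fin 3)) :
    |(S (su2ExpDrift δ ((p + (fun (W : ι → Matrix.specialUnitaryGroup (Fin 2) ℂ) (l : ι) => -(lam / κ) • (fun (W : ι → Matrix.specialUnitaryGroup (Fin 2) ℂ) (l : ι) => WithLp.toLp 2 (fun i : Fin 3 => fderiv ℝ (fun a : ι → EuclideanSpace ℝ (Fin 3) => S (su2ExpDrift δ a * W)) 0 (Pi.single l (EuclideanSpace.single i (1 : ℝ))))) W l) q) + (fun (W : ι → Matrix.specialUnitaryGroup (Fin 2) ℂ) (l : ι) => -((1 - 2 * lam) / κ) • (fun (W : ι → Matrix.specialUnitaryGroup (Fin 2) ℂ) (l : ι) => WithLp.toLp 2 (fun i : Fin 3 => fderiv ℝ (fun a : ι → EuclideanSpace ℝ (Fin 3) => S (su2ExpDrift δ a * W)) 0 (Pi.single l (EuclideanSpace.single i (1 : ℝ))))) W l) (su2ExpDrift δ (p + (fun (W : ι → Matrix.specialUnitaryGroup (Fin 2) ℂ) (l : ι) => -(lam / κ) • (fun (W : ι → Matrix.specialUnitaryGroup (Fin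 2) ℂ) (l : ι) => WithLp.toLp 2 (fun i : Fin 3 => fderiv ℝ (fun a : ι → EuclideanSpace ℝ (Fin 3) => S (su2ExpDrift δ a * W)) 0 (Pi.single l (EuclideanSpace.single i (1 : ℝ))))) W l) q) * q)) *
          (su2ExpDrift δ (p + (fun (W : ι → Matrix.specialUnitaryGroup (Fin 2) ℂ) (l : ι) => -(lam / κ) • (fun (W : ι → Matrix.specialUnitaryGroup (Fin 2) ℂ) (l : ι) => WithLp.toLp 2 (fun i : Fin 3 => fderiv ℝ (fun a : ι → EuclideanSpace ℝ (Fin 3) => S (su2ExpDrift δ a * W)) 0 (Pi.single l (EuclideanSpace.single i (1 : ℝ))))) W l) q) * q)) +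
        su2Kinetic κ (((p + (fun (W : ι → Matrix.specialUnitaryGroup (Fin 2) ℂ) (l : ι) => -(lam / κ) • (fun (W : ι → Matrix.specialUnitaryGroup (Fin 2) ℂ) (l : ι) => WithLp.toLp 2 (fun i : Fin 3 => fderiv ℝ (fun a : ι → EuclideanSpace ℝ (Fin 3) => S (su2ExpDrift δ a * W)) 0 (Pi.single l (EuclideanSpace.single i (1 : ℝ))))) W l) q) + (fun (W : ι → Matrix.specialUnitaryGroup (Fin 2) ℂ) (l : ι) => -((1 - 2 * lam) / κ) • (fun (W : ι → Matrix.specialUnitaryGroup (Fin 2) ℂ) (l : ι) => WithLp.toLp 2 (fun i : Fin 3 => fderiv ℝ (fun a : ι → EuclideanSpace ℝ (Fin 3) => S (su2ExpDrift δ a * W)) 0 (Pi.single l (EuclideanSpace.single i (1 : ℝ))))) W l) (su2ExpDrift δ (p + (fun (W : ι → Matrix.specialUnitaryGroup (Fin 2) ℂ) (l : ι) => -(lam / κ) • (fun (W : ι → Matrix.specialUnitaryGroup (Fin 2) ℂ) (l : ι) => WithLp.toLp 2 (fun i : Fin 3 => fderiv ℝ (fun a : ι → EuclideanSpace ℝ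 (Fin 3) => S (su2ExpDrift δ a * W)) 0 (Pi.single l (EuclideanSpace.single i (1 : ℝ))))) W l) q) * q)) +
          (fun (W : ι → Matrix.specialUnitaryGroup (Fin 2) ℂ) (l : ι) => -(lam / κ) • (fun (W : ι → Matrix.specialUnitaryGroup (Fin 2) ℂ) (l : ι) => WithLp.toLp 2 (fun i : Fin 3 => fderiv ℝ (fun a : ι → EuclideanSpace ℝ (Fin 3) => S (su2ExpDrift δ a * W)) 0 (Pi.single l (EuclideanSpace.single i (1 : ℝ))))) W l) (su2ExpDrift δ ((p + (fun (W : ι → Matrix.specialUnitaryGroup (Fin 2) ℂ) (l : ι) => -(lam / κ) • (fun (W : ι → Matrix.specialUnitaryGroup (Fin 2) ℂ) (l : ι) => WithLp.toLp 2 (fun i : Fin 3 => fderiv ℝ (fun a : ι → EuclideanSpace ℝ (Fin 3) => S (su2ExpDrift δ a * W)) 0 (Pi.single l (EuclideanSpace.single i (1 : ℝ))))) W l) q) + (fun (W : ι → Matrix.specialUnitaryGroup (Fin 2) ℂ) (l : ι) => -((1 - 2 * lam) / κ) • (fun (W : ι → Matrix.specialUnitaryGroup (Fin 2) ℂ) (l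 : ι) => WithLp.toLp 2 (fun i : Fin 3 => fderiv ℝ (fun a : ι → EuclideanSpace ℝ (Fin 3) => S (su2ExpDrift δ a * W)) 0 (Pi.single l (EuclideanSpace.single i (1 : ℝ))))) W l) (su2ExpDrift δ (p + (fun (W : ι → Matrix.specialUnitaryGroup (Fin 2) ℂ) (l : ι) => -(lam / κ) • (fun (W : ι → Matrix.specialUnitaryGroup (Fin 2) ℂ) (l : ι) => WithLp.toLp 2 (fun i : Fin 3 => fderiv ℝ (fun a : ι → EuclideanSpace ℝ (Fin 3) => S (su2ExpDrift δ a * W)) 0 (Pi.single l (EuclideanSpace.single i (1 : ℝ))))) W l) q) * q)) *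
            (su2ExpDrift δ (p + (fun (W : ι → Matrix.specialUnitaryGroup (Fin 2) ℂ) (l : ι) => -(lam / κ) • (fun (W : ι → Matrix.specialUnitaryGroup (Fin 2) ℂ) (l : ι) => WithLp.toLp 2 (fun i : Fin 3 => fderiv ℝ (fun a : ι → EuclideanSpace ℝ (Fin 3) => S (su2ExpDrift δ a * W)) 0 (Pi.single l (EuclideanSpace.single i (1 : ℝ))))) W l) q) * q)))) -
      (S q + su2Kinetic κ p)| ≤
      K * |δ| * (‖p‖ + (|lam| + |1 - 2 * lam|) * (Dmax / κ)) *
        ((8 * |1 - 2 * lam| + 16 * |lam| + 8) * (∑ l, ‖p l‖ + Fintype.card ι * ((|lam| + |1 - 2 * lam|) * (Dmax / κ))) +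
          32 * lam ^ 2 * (Fintype.card ι * Dmax / κ)) := by
  have hid := su2Omf2_energy_identity S δ κ lam hκ.ne' q p
  simp only at hid
  rw [hid]
  set D := (fun (W : ι → Matrix.specialUnitaryGroup (Fin 2) ℂ) (l : ι) => WithLp.toLp 2 (fun i : Fin 3 => fderiv ℝ (fun a : ι → EuclideanSpace ℝ (Fin 3) => S (su2ExpDrift δ a * W)) 0 (Pi.single l (EuclideanSpace.single i (1 : ℝ))))) with hD
  set g₁ := (fun (W : ι → Matrix.specialUnitaryGroup (Fin 2) ℂ) (l : ι) => -(lam / κ) • (fun (W : ι → Matrix.specialUnitaryGroup (Fin 2) ℂ) (l : ι) => WithLp.toLp 2 (fun i : Fin 3 => fderiv ℝ (fun a : ι → EuclideanSpace ℝ (Fin 3) => S (su2ExpDrift δ a * W)) 0 (Pi.single l (EuclideanSpace.single i (1 : ℝ))))) W l) with hg₁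
  set g₂ := (fun (W : ι → Matrix.specialUnitaryGroup (Fin 2) ℂ) (l : ι) => -((1 - 2 * lam) / κ) • (fun (W : ι → Matrix.specialUnitaryGroup (Fin 2) ℂ) (l : ι) => WithLp.toLp 2 (fun i : Fin 3 => fderiv ℝ (fun a : ι → EuclideanSpace ℝ (Fin 3) => S (su2ExpDrift δ a * W)) 0 (Pi.single l (EuclideanSpace.single i (1 : ℝ))))) W l) with hg₂
  set p₁ := p + g₁ q with hp₁
  set q₁ := su2ExpDrift δ p₁ * q with hq₁
  set p₂ := p₁ + g₂ q₁ with hp₂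
  set q₂ := su2ExpDrift δ p₂ * q₁ with hq₂
  set γ : ℝ := (|lam| + |1 - 2 * lam|) * (Dmax / κ) with hγ
  set P : ℝ := ‖p‖ + γ with hP
  set Sg : ℝ := ∑ l, ‖p l‖ + Fintype.card ι * γ with hSgdef
  have hγ0 : 0 ≤ γ := by rw [hγ]; positivity
  -- kicks are small
  have hk₁ : ∀ W, ‖g₁ W‖ ≤ |lam| * (Dmax / κ) := fun W => by rw [hg₁]; exact norm_su2FracKick_le S δ κ lam hκ hD0 hDb W
  have hk₂ : ∀ W, ‖g₂ W‖ ≤ |1 - 2 * lam| * (Dmax / κ) := fun W => by rw [hg₂]; exact norm_su2FracKick_le S δ κ (1 - 2 * lam) hκ hD0 hDb W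
  have hk₁l : ∀ W l, ‖g₁ W l‖ ≤ |lam| * (Dmax / κ) := fun W l => by rw [hg₁]; exact norm_su2FracKick_apply_le S δ κ lam hκ hDb W l
  have hk₂l : ∀ W l, ‖g₂ W l‖ ≤ |1 - 2 * lam| * (Dmax / κ) := fun W l => by rw [hg₂]; exact norm_su2FracKick_apply_le S δ κ (1 - 2 * lam) hκ hDb W l
  -- the momenta along the step are bounded by P, their link sums by Sg
  have hP₁ : ‖p₁‖ ≤ P := by
    rw [hP, hp₁, hγ]
    calc ‖p + g₁ q‖ ≤ ‖p‖ + ‖g₁ q‖ := norm_add_le _ _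
      _ ≤ ‖p‖ + |lam| * (Dmax / κ) := add_le_add le_rfl (hk₁ q)
      _ ≤ ‖p‖ + (|lam| + |1 - 2 * lam|) * (Dmax / κ) := by nlinarith [abs_nonneg (1 - 2 * lam), div_nonneg hD0 hκ.le]
  have hP₂ : ‖p₂‖ ≤ P := by
    rw [hP, hp₂, hp₁, hγ]
    calc ‖p + g₁ q + g₂ q₁‖ ≤ ‖p‖ + ‖g₁ q‖ + ‖g₂ q₁‖ := (norm_add_le _ _).trans (add_le_add (norm_add_le _ _) le_rfl)
      _ ≤ ‖p‖ + |lam| * (Dmax / κ) + |1 - 2 * lam| * (Dmax / κ) := add_le_add (add_le_add le_rfl (hk₁ q)) (hk₂ q₁)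
      _ = ‖p‖ + (|lam| + |1 - 2 * lam|) * (Dmax / κ) := by ring
  have hS1 : ∑ l, ‖p₁ l‖ ≤ Sg := by
    rw [hSgdef, hp₁, hγ]
    calc ∑ l, ‖(p + g₁ q) l‖ ≤ ∑ l, (‖p l‖ + |lam| * (Dmax / κ)) :=
          Finset.sum_le_sum fun l _ => by rw [Pi.add_apply]; exact (norm_add_le _ _).trans (add_le_add le_rfl (hk₁l q l))
      _ = ∑ l, ‖p l‖ + Fintype.card ι * (|lam| * (Dmax / κ)) := by
          rw [Finset.sum_add_distrib, Finset.sum_const, Finset.card_univ, nsmul_eq_mul]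
      _ ≤ ∑ l, ‖p l‖ + Fintype.card ι * ((|lam| + |1 - 2 * lam|) * (Dmax / κ)) := by
          gcongr; nlinarith [abs_nonneg (1 - 2 * lam), div_nonneg hD0 hκ.le]
  have hS2 : ∑ l, ‖p₂ l‖ ≤ Sg := by
    rw [hSgdef, hp₂, hp₁, hγ]
    calc ∑ l, ‖(p + g₁ q + g₂ q₁) l‖ ≤ ∑ l, (‖p l‖ + |lam| * (Dmax / κ) + |1 - 2 * lam| * (Dmax / κ)) :=
          Finset.sum_le_sum fun l _ => by
            rw [Pi.add_apply, Pi.add_apply]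
            exact (norm_add_le _ _).trans (add_le_add ((norm_add_le _ _).trans (add_le_add le_rfl (hk₁l q l))) (hk₂l q₁ l))
      _ = ∑ l, ‖p l‖ + Fintype.card ι * ((|lam| + |1 - 2 * lam|) * (Dmax / κ)) := by
          rw [Finset.sum_add_distrib, Finset.sum_add_distrib, Finset.sum_const, Finset.sum_const, Finset.card_univ, nsmul_eq_mul,
            nsmul_eq_mul]; ring
  have hP0 : 0 ≤ P := by rw [hP]; positivity
  have hSg0 : 0 ≤ Sg := by rw [hSgdef]; positivity
  -- the two drifts move the field by at most 8|δ|‖p₁‖ and 8|δ|‖p₂‖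
  have hdist₁ : ‖coeConfig q - coeConfig q₁‖ ≤ 8 * |δ| * ‖p₁‖ := by
    have h := norm_coeConfig_su2ExpDrift_sub_le δ q p₁ 0 1
    rw [zero_smul, su2ExpDrift_zero, one_mul, one_smul, zero_sub, abs_neg, abs_one, mul_one] at h
    exact h
  have hdist₂ : ‖coeConfig q₁ - coeConfig q₂‖ ≤ 8 * |δ| * ‖p₂‖ := by
    have h := norm_coeConfig_su2ExpDrift_sub_le δ q₁ p₂ 0 1
    rw [zero_smul, su2ExpDrift_zero, one_mul, one_smul, zero_sub, abs_neg, abs_one, mul_one] at h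
    exact h
  have hD01 : ∀ l, ‖D q l - D q₁ l‖ ≤ K * (8 * |δ| * P) := fun l =>
    ((norm_le_pi_norm (D q - D q₁) l).trans (hDK q q₁)).trans
      (mul_le_mul_of_nonneg_left (hdist₁.trans (by gcongr)) hK0)
  have hD12 : ∀ l, ‖D q₁ l - D q₂ l‖ ≤ K * (8 * |δ| * P) := fun l =>
    ((norm_le_pi_norm (D q₁ - D q₂) l).trans (hDK q₁ q₂)).trans
      (mul_le_mul_of_nonneg_left (hdist₂.trans (by gcongr)) hK0)
  have hD02 : ∀ l, ‖D q₂ l - D q l‖ ≤ K * (16 * |δ| * P) := by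
    intro l
    calc ‖D q₂ l - D q l‖ ≤ ‖D q₂ l - D q₁ l‖ + ‖D q₁ l - D q l‖ := norm_sub_le_norm_sub_add_norm_sub _ _ _
      _ ≤ K * (8 * |δ| * P) + K * (8 * |δ| * P) := by
          have e1 : ‖D q₂ l - D q₁ l‖ = ‖D q₁ l - D q₂ l‖ := norm_sub_rev (D q₂ l) (D q₁ l)
          have e2 : ‖D q₁ l - D q l‖ = ‖D q l - D q₁ l‖ := norm_sub_rev (D q₁ l) (D q l)
          rw [e1, e2]; exact add_le_add (hD12 l) (hD01 l)
      _ = K * (16 * |δ| * P) := by ring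
  -- term 1
  have h1 : |(1 - 2 * lam) * ∑ l, ⟪p₁ l, D q l - D q₁ l⟫_ℝ| ≤ |1 - 2 * lam| * (8 * K * |δ| * P * Sg) := by
    rw [abs_mul]
    refine mul_le_mul_of_nonneg_left ?_ (abs_nonneg _)
    refine (Finset.abs_sum_le_sum_abs _ _).trans ?_
    calc ∑ l, |⟪p₁ l, D q l - D q₁ l⟫_ℝ| ≤ ∑ l, ‖p₁ l‖ * (K * (8 * |δ| * P)) :=
          Finset.sum_le_sum fun l _ => (abs_real_inner_le_norm _ _).trans (mul_le_mul_of_nonneg_left (hD01 l) (norm_nonneg _))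
      _ = (∑ l, ‖p₁ l‖) * (K * (8 * |δ| * P)) := by rw [Finset.sum_mul]
      _ ≤ Sg * (K * (8 * |δ| * P)) := by gcongr
      _ = 8 * K * |δ| * P * Sg := by ring
  -- term 2
  have h2 : |2 * lam * ∑ l, ⟪p₂ l, D q₁ l - D q₂ l⟫_ℝ| ≤ 2 * |lam| * (8 * K * |δ| * P * Sg) := by
    rw [abs_mul, abs_mul, abs_two]
    refine mul_le_mul_of_nonneg_left ?_ (by positivity)
    refine (Finset.abs_sum_le_sum_abs _ _).trans ?_
    calc ∑ l, |⟪p₂ l, D q₁ l - D q₂ l⟫_ℝ| ≤ ∑ l, ‖p₂ l‖ * (K * (8 * |δ| * P)) :=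
          Finset.sum_le_sum fun l _ => (abs_real_inner_le_norm _ _).trans (mul_le_mul_of_nonneg_left (hD12 l) (norm_nonneg _))
      _ = (∑ l, ‖p₂ l‖) * (K * (8 * |δ| * P)) := by rw [Finset.sum_mul]
      _ ≤ Sg * (K * (8 * |δ| * P)) := by gcongr
      _ = 8 * K * |δ| * P * Sg := by ring
  -- term 3
  have h3 : |lam ^ 2 / κ * ∑ l, (‖D q₂ l‖ ^ 2 - ‖D q l‖ ^ 2)| ≤ lam ^ 2 / κ * (Fintype.card ι * (K * (16 * |δ| * P) * (2 * Dmax))) := by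
    rw [abs_mul, abs_of_nonneg (by positivity : (0 : ℝ) ≤ lam ^ 2 / κ)]
    refine mul_le_mul_of_nonneg_left ?_ (by positivity)
    refine (Finset.abs_sum_le_sum_abs _ _).trans ?_
    calc ∑ l, |‖D q₂ l‖ ^ 2 - ‖D q l‖ ^ 2| ≤ ∑ _l : ι, K * (16 * |δ| * P) * (2 * Dmax) := by
          refine Finset.sum_le_sum fun l _ => ?_
          rw [sq_sub_sq, abs_mul]
          have hs : |‖D q₂ l‖ + ‖D q l‖| ≤ 2 * Dmax := by
            rw [abs_of_nonneg (by positivity)]; linarith [hDb q₂ l, hDb q l]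
          have hd : |‖D q₂ l‖ - ‖D q l‖| ≤ K * (16 * |δ| * P) := (abs_norm_sub_norm_le _ _).trans (hD02 l)
          calc |‖D q₂ l‖ + ‖D q l‖| * |‖D q₂ l‖ - ‖D q l‖| ≤ (2 * Dmax) * (K * (16 * |δ| * P)) :=
              mul_le_mul hs hd (abs_nonneg _) (by positivity)
            _ = K * (16 * |δ| * P) * (2 * Dmax) := by ring
      _ = Fintype.card ι * (K * (16 * |δ| * P) * (2 * Dmax)) := by
          rw [Finset.sum_const, Finset.card_univ, nsmul_eq_mul]
  -- the two Taylor remainders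
  have h4 : |S q₁ - S q - ∑ l, ⟪D q l, p₁ l⟫_ℝ| ≤ 4 * |δ| * K * P * Sg := by
    have h := abs_action_su2ExpDrift_sub_linear_le S δ hd hK0 hDK q p₁
    have hm : 4 * |δ| * K * ‖p₁‖ * ∑ l, ‖p₁ l‖ ≤ 4 * |δ| * K * P * Sg :=
      mul_le_mul (mul_le_mul_of_nonneg_left hP₁ (by positivity)) hS1
        (Finset.sum_nonneg fun l _ => norm_nonneg _) (by positivity)
    exact h.trans hm
  have h5 : |S q₂ - S q₁ - ∑ l, ⟪D q₁ l, p₂ l⟫_ℝ| ≤ 4 * |δ| * K * P * Sg := by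
    have h := abs_action_su2ExpDrift_sub_linear_le S δ hd hK0 hDK q₁ p₂
    have hm : 4 * |δ| * K * ‖p₂‖ * ∑ l, ‖p₂ l‖ ≤ 4 * |δ| * K * P * Sg :=
      mul_le_mul (mul_le_mul_of_nonneg_left hP₂ (by positivity)) hS2
        (Finset.sum_nonneg fun l _ => norm_nonneg _) (by positivity)
    exact h.trans hm
  -- assemble
  have hsum := abs_add_le
    ((1 - 2 * lam) * ∑ l, ⟪p₁ l, D q l - D q₁ l⟫_ℝ + 2 * lam * ∑ l, ⟪p₂ l, D q₁ l - D q₂ l⟫_ℝ +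
      lam ^ 2 / κ * ∑ l, (‖D q₂ l‖ ^ 2 - ‖D q l‖ ^ 2))
    ((S q₁ - S q - ∑ l, ⟪D q l, p₁ l⟫_ℝ) + (S q₂ - S q₁ - ∑ l, ⟪D q₁ l, p₂ l⟫_ℝ))
  have hA := abs_add_three ((1 - 2 * lam) * ∑ l, ⟪p₁ l, D q l - D q₁ l⟫_ℝ) (2 * lam * ∑ l, ⟪p₂ l, D q₁ l - D q₂ l⟫_ℝ)
    (lam ^ 2 / κ * ∑ l, (‖D q₂ l‖ ^ 2 - ‖D q l‖ ^ 2))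
  have hB := abs_add_le (S q₁ - S q - ∑ l, ⟪D q l, p₁ l⟫_ℝ) (S q₂ - S q₁ - ∑ l, ⟪D q₁ l, p₂ l⟫_ℝ)
  have htot : (|1 - 2 * lam| * (8 * K * |δ| * P * Sg)) + 2 * |lam| * (8 * K * |δ| * P * Sg) +
      lam ^ 2 / κ * (Fintype.card ι * (K * (16 * |δ| * P) * (2 * Dmax))) + (4 * |δ| * K * P * Sg + 4 * |δ| * K * P * Sg) =
      K * |δ| * P * ((8 * |1 - 2 * lam| + 16 * |lam| + 8) * Sg + 32 * lam ^ 2 * (Fintype.card ι * Dmax / κ)) := by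
    field_simp
    ring
  linarith [hsum, hA, hB, h1, h2, h3, h4, h5, htot]


end Summit.Ventures.LatticeQCDFlow.Exactness
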